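import Literature.NumberTheory.Rogawski1990.LocalTransferSplitPlaceClasses
import Literature.NumberTheory.Rogawski1990.GlobalTransferFactor
import HarnessLib

/-!
# [Rogawski1990 §4.9 Prop. 4.9.1 (b)] The unit fundamental lemma at a place SPLIT in `L`, in the LETTER's currency:
# `IsLocalUnitTransfer` reduces to ONE identity per matching pair `γ_H → γ₀`
(Rogawski (1990), §4.9 Prop. 4.9.1 (b) p. 55 «`Δ_{G∕H}(γ)Φ^κ(γ, f) = Φ^st(γ, f^H)` where `f` and `f^H` are the units of the Hecke algebras»;
§14.2 p. 232 and §3.1 p. 19: at a split place stable conjugacy is conjugacy and `κ = +1`)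

Topic `NumberTheory/Rogawski1990`; namespace `Literature.NumberTheory.Rogawski1990`. THEOREMS ONLY (no definition, no instance, no named fact,
no `sorry`). Cell `pub/hodgecm-mathlib`, programme P3a, letter **N7 (#103)** ★ `UnitFundamentalLemmaExplicitClosed` — row «D-N7s-G» (LEAD F0P3a-plan (g8)):
the LOCAL ASSEMBLY at a split place, first half. The letter's local clause is ★ `IsLocalUnitTransfer L H′ v T mH mG` (`GlobalTransferFactor` :274) `:=`
★ `IsLocalDeltaTransfer … 1_{K_H} 1_{K′}` `:=` ★ `IsDeltaTransferRel`: for every `G`-regular `γ_H ∈ H_v = U(Φ₂)_v × U(Φ₁)_v`,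
`Φ^st_H(γ_H, 1_{K_H}) = Σ_{[γ]} Δ_v(γ_H, [γ]) Φ([γ], 1_{K′})`. At a place `v` of `L⁺` SPLIT in `L` (`w ∣ v`, `w̄ ≠ w`) ★ `LocalTransferSplitPlaceClasses`
(«D-N6s» B3) shows: the `H`-side stable orbital integral is ONE orbital integral (★ `stableOrbitalIntegralRel_isLocalStablyConjH_eq_of_split`), every `γ_H`
has a match `γ₀ ∈ G′_v = U(H′)_v` (★ `exists_isLocalNormPair_of_split`) and the `G`-side sum has ONE term (★ `finsum_delta_mul_classOrbitalIntegral_eq_of_split`).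
Hence:

* **`isLocalUnitTransfer_iff_forall_isLocalNormPair_of_split`** — at a split place, for ANY local transfer factor `T`, ANY orbital measure
  families `mH`, `mG`: `IsLocalUnitTransfer L H′ v T mH mG ↔ ∀ γ_H` `G`-regular, `∀ γ₀` with `IsLocalNormPair L H′ v γ_H γ₀`,
  `Φ([γ_H], 1_{K_H}; mH) = Δ_v(γ_H, γ₀) · Φ([γ₀], 1_{K′}; mG)` — THE PER-PAIR IDENTITY; `isLocalUnitTransfer_of_forall_isLocalNormPair_of_split`
  (the direction the closer consumes).

The per-pair identity itself — `Δ‴_v(γ_H, γ₀) · Φ^{G′_v}(γ₀, 1_{K′}) = Φ^{H_v}(γ_H, 1_{K_H})` for the CANONICAL families and the explicit factor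
★ `finExplicitDelta_eq_tau_mul_weyl_of_split` (`Δ‴_v = τ_v · D_{G∕H,v}`, `κ_v = +1`) — is assembled from ★ `UnitFundamentalLemmaSplitPlaceBochner`
(«D-N7s-E»: `Φ^{G′_v}(γ₀, 1_{K′}) = c · |D_{G∕M}|^{−1∕2} δ_P^{1∕2} Φ^{M}(p, 1_{K_M})`), ★ `finWeylRatio_eq_boxAd_of_split` («D-S2r»), the constant-one pin
(«D-S1c-canonical» ∕ «D-S1c-one», ★ `GLnLeviOrbitalDescentCanonical`), the value of `τ_v` (B6) and the `H_v ≅ M` frame transport (B4′) — the second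
half of this row, NOT in this file. Nothing is claimed at non-split places. HC_CM is proved only modulo the printed citations until rung 0 closes;
this file discharges none of them.

## References
* J. D. Rogawski, *Automorphic Representations of Unitary Groups in Three Variables* (1990), §4.9 Prop. 4.9.1 (b) p. 55; §4.3 (4.3.1)–(4.3.2)
  p. 43; §14.2 p. 232; §3.1 p. 19 [Rogawski1990].
* C. P. Mok, *Endoscopic classification of representations of quasi-split unitary groups* (2015), §1 p. 5 [Mok2014].
-/

set_option autoImplicit false

noncomputable section

open MeasureTheory NumberField IsDedekindDomain Literature.NumberTheory.Automorphic Literature.NumberTheory.Automorphic.UnitaryGroup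
open scoped Matrix MatrixGroups

namespace Literature.NumberTheory.Rogawski1990

section Split

variable (L : Type) [Field L] [NumberField L] [IsCMField L] (H' : Matrix (Fin 3) (Fin 3) L)
  {v : HeightOneSpectrum (𝓞 ↥(maximalRealSubfield L))} (hc : IsCMField.complexConj L ≠ 1)
  (w : UnitaryGroup.PlacesOver L v) (hw : IsCMField.complexConj L • w.1 ≠ w.1)
  (hΦ₂ : ((Matrix.of fun i j : Fin 2 => if i.val + j.val + 1 = 2 then (1 : L) else 0).map (IsCMField.complexConj L))ᵀ =
    Matrix.of fun i j : Fin 2 => if i.val + j.val + 1 = 2 then (1 : L) else 0)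
  (hΦ₂w : IsUnit (placeForm (Matrix.of fun i j : Fin 2 => if i.val + j.val + 1 = 2 then (1 : L) else 0) w.1))
  (hΦ₂d : (Matrix.of fun i j : Fin 2 => if i.val + j.val + 1 = 2 then (1 : L) else 0).det ≠ 0)
  (hΦ₁ : ((Matrix.of fun i j : Fin 1 => if i.val + j.val + 1 = 1 then (1 : L) else 0).map (IsCMField.complexConj L))ᵀ =
    Matrix.of fun i j : Fin 1 => if i.val + j.val + 1 = 1 then (1 : L) else 0)
  (hΦ₁w : IsUnit (placeForm (Matrix.of fun i j : Fin 1 => if i.val + j.val + 1 = 1 then (1 : L) else 0) w.1))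
  (hΦ₁d : (Matrix.of fun i j : Fin 1 => if i.val + j.val + 1 = 1 then (1 : L) else 0).det ≠ 0)
  (hH' : (H'.map (IsCMField.complexConj L))ᵀ = H') (hH'w : IsUnit (placeForm H' w.1))
  {_ha : ∀ a : ((UnitaryGroup.cmDatum L 2 (Matrix.of fun i j : Fin 2 => if i.val + j.val + 1 = 2 then (1 : L) else 0)).Local v ×
      (UnitaryGroup.cmDatum L 1 (Matrix.of fun i j : Fin 1 => if i.val + j.val + 1 = 1 then (1 : L) else 0)).Local v),
    MeasurableSpace (((UnitaryGroup.cmDatum L 2 (Matrix.of fun i j : Fin 2 => if i.val + j.val + 1 = 2 then (1 : L) else 0)).Local v ×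
      (UnitaryGroup.cmDatum L 1 (Matrix.of fun i j : Fin 1 => if i.val + j.val + 1 = 1 then (1 : L) else 0)).Local v) ⧸
      Subgroup.centralizer ({a} : Set ((UnitaryGroup.cmDatum L 2 (Matrix.of fun i j : Fin 2 => if i.val + j.val + 1 = 2 then (1 : L) else 0)).Local v ×
      (UnitaryGroup.cmDatum L 1 (Matrix.of fun i j : Fin 1 => if i.val + j.val + 1 = 1 then (1 : L) else 0)).Local v)))}
  {_hγ : ∀ γ : (UnitaryGroup.cmDatum L 3 H').Local v,
    MeasurableSpace ((UnitaryGroup.cmDatum L 3 H').Local v ⧸ Subgroup.centralizer ({γ} : Set ((UnitaryGroup.cmDatum L 3 H').Local v)))}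
  (T : LocalTransferFactor L H' v)
  (mH : OrbitalMeasureFamily ((UnitaryGroup.cmDatum L 2 (Matrix.of fun i j : Fin 2 => if i.val + j.val + 1 = 2 then (1 : L) else 0)).Local v ×
      (UnitaryGroup.cmDatum L 1 (Matrix.of fun i j : Fin 1 => if i.val + j.val + 1 = 1 then (1 : L) else 0)).Local v))
  (mG : OrbitalMeasureFamily ((UnitaryGroup.cmDatum L 3 H').Local v))

include hc hw hΦ₂ hΦ₂w hΦ₂d hΦ₁ hΦ₁w hΦ₁d hH' hH'w in
/-- **N7 at a split place, «⇐»: the per-pair identity implies the letter's local clause.** If for every `G`-regular `γ_H ∈ H_v` and every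
match `γ₀ ∈ U(H′)_v` (`IsLocalNormPair`), `Φ([γ_H], 1_{K_H}; mH) = Δ_v(γ_H, γ₀) · Φ([γ₀], 1_{K′}; mG)`, then `IsLocalUnitTransfer L H′ v T mH mG`
(★ `stableOrbitalIntegralRel_isLocalStablyConjH_eq_of_split` + ★ `finsum_delta_mul_classOrbitalIntegral_eq_of_split` + ★
`exists_isLocalNormPair_of_split`). [cite: Rogawski1990, §4.9 Prop. 4.9.1 (b) p. 55] [cite: Rogawski1990, §14.2 p. 232] -/
theorem isLocalUnitTransfer_of_forall_isLocalNormPair_of_split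
    (h : ∀ γH : (UnitaryGroup.cmDatum L 2 (Matrix.of fun i j : Fin 2 => if i.val + j.val + 1 = 2 then (1 : L) else 0)).Local v ×
        (UnitaryGroup.cmDatum L 1 (Matrix.of fun i j : Fin 1 => if i.val + j.val + 1 = 1 then (1 : L) else 0)).Local v,
      IsLocalGRegular L v γH → ∀ γ₀ : (UnitaryGroup.cmDatum L 3 H').Local v, IsLocalNormPair L H' v γH γ₀ →
        classOrbitalIntegral mH
            ((((UnitaryGroup.cmLocalIntegralLevel L 2 (Matrix.of fun i j : Fin 2 => if i.val + j.val + 1 = 2 then (1 : L) else 0) v).prod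
              (UnitaryGroup.cmLocalIntegralLevel L 1 (Matrix.of fun i j : Fin 1 => if i.val + j.val + 1 = 1 then (1 : L) else 0) v) :
                Subgroup ((UnitaryGroup.cmDatum L 2 (Matrix.of fun i j : Fin 2 => if i.val + j.val + 1 = 2 then (1 : L) else 0)).Local v ×
                  (UnitaryGroup.cmDatum L 1 (Matrix.of fun i j : Fin 1 => if i.val + j.val + 1 = 1 then (1 : L) else 0)).Local v)) :
              Set ((UnitaryGroup.cmDatum L 2 (Matrix.of fun i j : Fin 2 => if i.val + j.val + 1 = 2 then (1 : L) else 0)).Local v ×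
                (UnitaryGroup.cmDatum L 1 (Matrix.of fun i j : Fin 1 => if i.val + j.val + 1 = 1 then (1 : L) else 0)).Local v)).indicator
            fun _ => (1 : ℂ)) (ConjClasses.mk γH) =
          T.Δ γH γ₀ * classOrbitalIntegral mG
            ((UnitaryGroup.cmLocalIntegralLevel L 3 H' v : Set ((UnitaryGroup.cmDatum L 3 H').Local v)).indicator fun _ => (1 : ℂ))
            (ConjClasses.mk γ₀)) :
    IsLocalUnitTransfer L H' v T mH mG := by
  intro γH hreg
  obtain ⟨γ₀, h₀, -⟩ := exists_isLocalNormPair_of_split L H' hc w hw hΦ₂ hΦ₂w hΦ₁ hΦ₁w hH' hH'w γH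
  rw [stableOrbitalIntegralRel_isLocalStablyConjH_eq_of_split L w hw hΦ₂ hΦ₂d hΦ₁ hΦ₁d mH _ γH,
    finsum_delta_mul_classOrbitalIntegral_eq_of_split L H' hH' w hw hH'w T mG _ h₀]
  exact h γH hreg γ₀ h₀

include hc hw hΦ₂ hΦ₂w hΦ₂d hΦ₁ hΦ₁w hΦ₁d hH' hH'w in
/-- **N7 at a split place IS the per-pair identity** (`↔`): `IsLocalUnitTransfer L H′ v T mH mG` iff for every `G`-regular `γ_H` and every match
`γ₀`, `Φ([γ_H], 1_{K_H}; mH) = Δ_v(γ_H, γ₀) · Φ([γ₀], 1_{K′}; mG)`. [cite: Rogawski1990, §4.9 Prop. 4.9.1 (b) p. 55] [cite: Rogawski1990, §4.3 (4.3.1) p. 43] -/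
theorem isLocalUnitTransfer_iff_forall_isLocalNormPair_of_split :
    IsLocalUnitTransfer L H' v T mH mG ↔
      ∀ γH : (UnitaryGroup.cmDatum L 2 (Matrix.of fun i j : Fin 2 => if i.val + j.val + 1 = 2 then (1 : L) else 0)).Local v ×
          (UnitaryGroup.cmDatum L 1 (Matrix.of fun i j : Fin 1 => if i.val + j.val + 1 = 1 then (1 : L) else 0)).Local v,
        IsLocalGRegular L v γH → ∀ γ₀ : (UnitaryGroup.cmDatum L 3 H').Local v, IsLocalNormPair L H' v γH γ₀ →
          classOrbitalIntegral mH
              ((((UnitaryGroup.cmLocalIntegralLevel L 2 (Matrix.of fun i j : Fin 2 => if i.val + j.val + 1 = 2 then (1 : L) else 0) v).prod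
                (UnitaryGroup.cmLocalIntegralLevel L 1 (Matrix.of fun i j : Fin 1 => if i.val + j.val + 1 = 1 then (1 : L) else 0) v) :
                  Subgroup ((UnitaryGroup.cmDatum L 2 (Matrix.of fun i j : Fin 2 => if i.val + j.val + 1 = 2 then (1 : L) else 0)).Local v ×
                    (UnitaryGroup.cmDatum L 1 (Matrix.of fun i j : Fin 1 => if i.val + j.val + 1 = 1 then (1 : L) else 0)).Local v)) :
                Set ((UnitaryGroup.cmDatum L 2 (Matrix.of fun i j : Fin 2 => if i.val + j.val + 1 = 2 then (1 : L) else 0)).Local v ×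
                  (UnitaryGroup.cmDatum L 1 (Matrix.of fun i j : Fin 1 => if i.val + j.val + 1 = 1 then (1 : L) else 0)).Local v)).indicator
              fun _ => (1 : ℂ)) (ConjClasses.mk γH) =
            T.Δ γH γ₀ * classOrbitalIntegral mG
              ((UnitaryGroup.cmLocalIntegralLevel L 3 H' v : Set ((UnitaryGroup.cmDatum L 3 H').Local v)).indicator fun _ => (1 : ℂ))
              (ConjClasses.mk γ₀) := by
  refine ⟨fun h γH hreg γ₀ h₀ => ?_,
    isLocalUnitTransfer_of_forall_isLocalNormPair_of_split L H' hc w hw hΦ₂ hΦ₂w hΦ₂d hΦ₁ hΦ₁w hΦ₁d hH' hH'w T mH mG⟩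
  have h1 := h γH hreg
  rw [stableOrbitalIntegralRel_isLocalStablyConjH_eq_of_split L w hw hΦ₂ hΦ₂d hΦ₁ hΦ₁d mH _ γH,
    finsum_delta_mul_classOrbitalIntegral_eq_of_split L H' hH' w hw hH'w T mG _ h₀] at h1
  exact h1

end Split

end Literature.NumberTheory.Rogawski1990

end
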